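import Summits.Ventures.PercRepro.RankLevelSetLevelThirteenGXTForm
import Summits.Ventures.PercRepro.RankLevelSetCoreThirteenOfFormGXT
import Summits.Ventures.PercRepro.RankLevelSetCoreThirteenLargeCorankGXT
import Summits.Ventures.PercRepro.RankLevelSetLevelTwelveGXT
import Summits.Ventures.PercRepro.S3SixWindow

/-!
# PercRepro — THEOREM C₁₃ ON THE GIANT-EXACT COUNT WITH LEMMA T5: C-025 AT LEVEL `13` FOR EVERY FINITE MATROID AND EVERY
`p ≥ 4027` (p2, gen 37; a feeder for S4 — the top of the `q = 13` window, from `5,400`)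

The level-`13` instance of the GXT chains of RankLevelSetLevelTwelveGXT: p8 g18's giant-exact count
(`S2.ncard_eRk_eq_ncard_le_le_giant_exact`) with the quartic multiplicity on the non-giant rank-`12` sets and the powerset of the
giant flat, p8's LEMMA T5 (`s₅ ≤ 7·d(d+1)(d+2)(d+3)/48`), the flat bounds `f(13) ≤ 5119`, `f(12) ≤ 2559`
(RankLevelSetLevelThirteenInfraGXT), the mid weight in CLOSED FORM (RankLevelSetLevelTwelveSigmaBarGXT) and the TRUNCATED `Y`-tails
(the spanning tail never expanded): every cell `(p, d)`, `14 ≤ d ≤ 5257`, closes at the UNIFORM base `p ≥ 4027` (the 5244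
polynomial certificates of RankLevelSetLevelThirteenGXTArith{AA…}, the tail bases of RankLevelSetLevelThirteenGXTTails{AA…},
the dispatcher `gxt_form_thirteen`), and the large-corank regime closes from corank `5258` (`largeThirteen_all_gxt`); the rows
`≤ 4026` fail at the giant-powerset band `d = 5081 … 5106` on the `N`-side (`4026` exactly at `(4026, 5105)` and `(4026, 5106)`; kits j332714 / j333430).
* **`c025_core_thirteen_bounded_corank_gxt`** — the `e`-free core at level `13`, corank `14 ≤ d ≤ 5257`, rank `p ≥ 4027`;
* **`c025_thirteen_of_twelve_gxt_from`** — for every `P ≥ 4027`: level `12` for all `p ≥ P` implies level `13` for all `p ≥ P + 1`;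
* **`c025_thirteen_at_forty_twenty_seven`** — level `13` at rank `4027`, every finite matroid (the per-rank wrapper
  `rls_succ_large_at 12 13 4027` on level `12` at `4026`, `c025_twelve_large_gxt'`);
* **`c025_thirteen_large_gxt'`** — UNCONDITIONAL over the tree: level `13` for every `p ≥ 4027`; **`c025_thirteen_large_gxt`** the same
  in the literal `C025` body.
Axioms: standard.
-/

open scoped Matroid

namespace PercRepro

namespace ThmN

open Set

variable {α : Type}

/-- **The `e`-free core at level `13`, corank `14 ≤ d ≤ 5257`, rank `p ≥ 4027`, on the giant-exact count with LEMMA T5**: the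
form of the cell from `gxt_form_thirteen` through `c025_core_thirteen_of_form_gxt`. -/
theorem c025_core_thirteen_bounded_corank_gxt (M : Matroid α) [M.Finite] (p d : ℕ) (hp : 4027 ≤ p) (hd14 : 14 ≤ d)
    (hd5257 : d ≤ 5257) (hR : M.eRank = (p : ℕ∞)) (hn : M.E.ncard = p + d)
    (hfree : ∀ e ∈ M.E, ∃ A ⊆ M.E \ {e}, e ∉ M.closure A ∧ e ∉ M.closure ((M.E \ {e}) \ A)) :
    RLS M p 13 :=
  c025_core_thirteen_of_form_gxt M p d hd14 hR hn hfree (gxt_form_thirteen d hd14 hd5257 p hp (p + d) (by omega))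

/-- **THEOREM C₁₃ ON THE GIANT-EXACT COUNT WITH LEMMA T5, GIVEN LEVEL `12` FROM `P`**: for every `P ≥ 4027`, level `12` for all
`p ≥ P` implies level `13` for all `p ≥ P + 1` (the core at corank `14 ≤ d ≤ 5257` by `c025_core_thirteen_bounded_corank_gxt`, at
corank `≥ 5258` by `c025_core_thirteen_large_corank_gxt`; the coranks `≤ 13` are `U = ∅` or Theorem M). -/
theorem c025_thirteen_of_twelve_gxt_from (P : ℕ) (hP : 4027 ≤ P)
    (h12 : ∀ (M : Matroid α) [M.Finite] (p : ℕ), P ≤ p → RLS M p 12) :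
    ∀ (M : Matroid α) [M.Finite] (p : ℕ), P + 1 ≤ p → RLS M p 13 := by
  intro M _ p hp
  refine rls_succ_large (α := α) 12 13 P ?_ ?_ ?_ M p hp (by omega)
  · intro M' _ p' hP' _
    exact h12 M' p' hP'
  · intro M' _ p' _ hn _
    rcases Nat.lt_or_ge M'.E.ncard (p' + 13) with h | h
    · exact RLS_of_ncard_lt M' h
    · exact RLS_of_ncard_eq M' (by omega)
  · intro M' _ p' hP' hR hbig _ hfree
    rcases Nat.lt_or_ge M'.E.ncard (p' + 5258) with h | h
    · exact c025_core_thirteen_bounded_corank_gxt M' p' (M'.E.ncard - p') (by omega) (by omega) (by omega) hR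
        (by omega) hfree
    · exact c025_core_thirteen_large_corank_gxt M' p' (by omega) hR (by omega) hfree

/-- **Level `13` at rank `4027`, every finite matroid**: `rls_succ_large_at 12 13 4027` on level `12` at `4026`
(`c025_twelve_large_gxt'`), the coranks `≤ 13` (`U = ∅` or Theorem M) and the core at `4027`. -/
theorem c025_thirteen_at_forty_twenty_seven (M : Matroid α) [M.Finite] : RLS M 4027 13 := by
  refine rls_succ_large_at (α := α) 12 13 4027 (by norm_num)
    (fun M _ => c025_twelve_large_gxt' M 4026 (by norm_num)) ?_ ?_ M
  · -- corank `≤ 13`: `U = ∅` or Theorem M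
    intro M _ hn
    rcases Nat.lt_or_ge M.E.ncard (4027 + 13) with h | h
    · exact RLS_of_ncard_lt M h
    · exact RLS_of_ncard_eq M (by omega)
  · -- the core at corank `≥ 14`
    intro M _ hR hbig hfree
    rcases Nat.lt_or_ge M.E.ncard (4027 + 5258) with h | h
    · exact c025_core_thirteen_bounded_corank_gxt M 4027 (M.E.ncard - 4027) (le_refl _) (by omega) (by omega) hR
        (by omega) hfree
    · exact c025_core_thirteen_large_corank_gxt M 4027 (le_refl _) hR (by omega) hfree

/-- **THEOREM C₁₃ AT `4027`, UNCONDITIONAL OVER THE TREE**: every finite matroid satisfies C-025 at level `13` for every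
`p ≥ 4027` — the row `4027` by `c025_thirteen_at_forty_twenty_seven`, the rows `≥ 4028` through the wrapper at `P = 4027` on level `12`
for `p ≥ 1880` (`c025_twelve_large_gxt'`). -/
theorem c025_thirteen_large_gxt' (M : Matroid α) [M.Finite] (p : ℕ) (hp : 4027 ≤ p) : RLS M p 13 := by
  rcases Nat.lt_or_ge p 4028 with h | h
  · have h4027 : p = 4027 := by omega
    subst h4027
    exact c025_thirteen_at_forty_twenty_seven M
  · exact c025_thirteen_of_twelve_gxt_from 4027 (by norm_num)
      (fun M' _ p' hp' => c025_twelve_large_gxt' M' p' (by omega)) M p h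

/-- The same in the literal `C025` body: `phiK p 13 · #U(p, 13) ≤ #Y(p, 13)` for every finite matroid and every `p ≥ 4027`. -/
theorem c025_thirteen_large_gxt (M : Matroid α) [M.Finite] (p : ℕ) (hp : 4027 ≤ p) :
    phiK p 13 * ({A : Set α | A ⊆ M.E ∧ M.eRk A = (p : ℕ∞) ∧ M.eRk (M.E \ A) = (13 : ℕ∞)}.ncard : ℚ) ≤
      ({A : Set α | A ⊆ M.E ∧ (13 : ℕ∞) < M.eRk A ∧ M.eRk A < (p : ℕ∞)}.ncard : ℚ) :=
  c025_thirteen_large_gxt' M p hp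

end ThmN

end PercRepro
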